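import Summits.QuantumAdvantage.QuantumAdvantage.Theses.SosSandwich
import Literature.Computability.QuantumComplexity.InfluenceBounds

/-!
# Route `SosSandwich`, support `PseudoBoundedDual` (stmt-QuantumAdvantage-15244) — part 1: the SOS cone of order `T`

The set `C_T` of real functions on the cube `{0,1}^N` that are sums of squares of polynomials of total degree
`≤ T` is described in the Walsh basis: `f ∈ C_T ↔ f = Σ_{a,b} Q_{ab} χ_a χ_b` for a positive semidefinite
matrix `Q` indexed by the sets of size `≤ T` (Gram representation), and `C_T` is CLOSED (a PSD Gram matrix is
bounded by the average of the function it represents, `tr Q = E_x f(x)`, so limits lift by compactness).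
-/

set_option linter.dupNamespace false -- D-0017: single-problem summit ⇒ `QuantumAdvantage.QuantumAdvantage` by design

namespace Summit.QuantumAdvantage.QuantumAdvantage.Theorems.SosSandwich

open Finset MvPolynomial Matrix Literature.Computability.QuantumComplexity
  Literature.Computability.Complexity.LowDegree Literature.Probability.RandomGraphs.LowDegree
open scoped MatrixOrder

variable {N : ℕ}

/-! ### Walsh characters as polynomials of total degree `|S|` -/

/-- `∏_{i∈S} (1 - 2 X_i)` has total degree `≤ |S|`. [folklore] -/
theorem totalDegree_walshProd_le (S : Finset (Fin N)) :
    (∏ i ∈ S, (1 - 2 * X i : MvPolynomial (Fin N) ℝ)).totalDegree ≤ S.card := by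
  refine (totalDegree_finsetProd _ _).trans ?_
  rw [Finset.card_eq_sum_ones]
  refine Finset.sum_le_sum fun i _ => ?_
  refine (totalDegree_sub _ _).trans (max_le ?_ ?_)
  · rw [totalDegree_one]; exact Nat.zero_le _
  · refine (totalDegree_mul _ _).trans ?_
    have h2 : (2 : MvPolynomial (Fin N) ℝ) = C 2 := by rfl
    rw [h2, totalDegree_C, totalDegree_X, zero_add]

/-- On the cube, `∏_{i∈S} (1 - 2 X_i)` evaluates to the Walsh character `χ_S`. [cite: ODonnell2014, §1.2] -/
theorem evalBool_walshProd (S : Finset (Fin N)) (x : Fin N → Bool) :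
    evalBool (∏ i ∈ S, (1 - 2 * X i : MvPolynomial (Fin N) ℝ)) x = walsh S x := by
  unfold evalBool walsh
  rw [map_prod]
  refine Finset.prod_congr rfl fun i _ => ?_
  cases h : x i
  · simp [h, sgn]
  · simp [h, sgn]
    norm_num

/-- A polynomial of total degree `≤ T` is, on the cube, its Walsh expansion over the sets of size `≤ T`.
[cite: ODonnell2014, Thm 1.1] -/
theorem evalBool_eq_sum_walsh {T : ℕ} {q : MvPolynomial (Fin N) ℝ} (hq : q.totalDegree ≤ T)
    (x : Fin N → Bool) :
    evalBool q x = ∑ a : {S : Finset (Fin N) // S.card ≤ T},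
      cubeFourierCoeff (evalBool q) a.1 * walsh a.1 x := by
  classical
  rw [← sum_cubeFourierCoeff_mul_walsh (evalBool q) x]
  rw [show (∑ a : {S : Finset (Fin N) // S.card ≤ T}, cubeFourierCoeff (evalBool q) a.1 * walsh a.1 x) =
      ∑ S ∈ Finset.univ.filter (fun S : Finset (Fin N) => S.card ≤ T),
        cubeFourierCoeff (evalBool q) S * walsh S x from
    (Finset.sum_subtype _ (fun S => by simp) (fun S => cubeFourierCoeff (evalBool q) S * walsh S x)).symm]
  rw [Finset.sum_filter]
  refine Finset.sum_congr rfl fun S _ => ?_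
  split_ifs with h
  · rfl
  · rw [cubeFourierCoeff_evalBool_eq_zero hq (by omega), zero_mul]

/-! ### Gram representation of the SOS cone -/

/-- Forward Gram representation: a sum of squares of polynomials of degree `≤ T` is `x ↦ Σ_{a,b} Q_{ab} χ_a(x) χ_b(x)`
with `Q = Bᵀ B` positive semidefinite (`B_{ja} = q̂_j(a)`). [folklore] -/
theorem exists_psd_of_sos {T m : ℕ} (q : Fin m → MvPolynomial (Fin N) ℝ)
    (hdeg : ∀ j, (q j).totalDegree ≤ T) :
    ∃ Q : Matrix {S : Finset (Fin N) // S.card ≤ T} {S : Finset (Fin N) // S.card ≤ T} ℝ,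
      Q.PosSemidef ∧ ∀ x : Fin N → Bool,
        ∑ j, evalBool (q j) x ^ 2 = ∑ a, ∑ b, Q a b * (walsh a.1 x * walsh b.1 x) := by
  classical
  let B : Matrix (Fin m) {S : Finset (Fin N) // S.card ≤ T} ℝ :=
    fun j a => cubeFourierCoeff (evalBool (q j)) a.1
  refine ⟨Bᴴ * B, posSemidef_conjTranspose_mul_self B, fun x => ?_⟩
  have hmul : ∀ a b : {S : Finset (Fin N) // S.card ≤ T}, (Bᴴ * B) a b = ∑ j, B j a * B j b := by
    intro a b
    rw [Matrix.mul_apply]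
    refine Finset.sum_congr rfl fun j _ => ?_
    rw [conjTranspose_apply, star_trivial]
  simp_rw [hmul]
  -- Σ_j (Σ_a B j a χ_a)² = Σ_a Σ_b (Σ_j B j a B j b) χ_a χ_b
  have e : ∀ j, evalBool (q j) x ^ 2 = ∑ a, ∑ b, B j a * B j b * (walsh a.1 x * walsh b.1 x) := by
    intro j
    rw [evalBool_eq_sum_walsh (hdeg j), sq, Finset.sum_mul_sum]
    refine Finset.sum_congr rfl fun a _ => Finset.sum_congr rfl fun b _ => ?_
    ring
  simp_rw [e]
  rw [Finset.sum_comm]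
  refine Finset.sum_congr rfl fun a _ => ?_
  rw [Finset.sum_comm]
  refine Finset.sum_congr rfl fun b _ => ?_
  rw [Finset.sum_mul]


/-- Backward Gram representation: for a positive semidefinite `Q`, the function `x ↦ Σ_{a,b} Q_{ab} χ_a(x) χ_b(x)` is a
sum of squares of polynomials of total degree `≤ T` (write `Q` as a sum of `sᴴ s`, rows of `s` give the squares).
[folklore] -/
theorem sos_of_psd {T : ℕ} (Q : Matrix {S : Finset (Fin N) // S.card ≤ T} {S : Finset (Fin N) // S.card ≤ T} ℝ)
    (hQ : Q.PosSemidef) :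
    ∃ (m : ℕ) (q : Fin m → MvPolynomial (Fin N) ℝ), (∀ j, (q j).totalDegree ≤ T) ∧
      ∀ x : Fin N → Bool, ∑ a, ∑ b, Q a b * (walsh a.1 x * walsh b.1 x) = ∑ j, evalBool (q j) x ^ 2 := by
  classical
  -- the property, for a general matrix A
  let P : Matrix {S : Finset (Fin N) // S.card ≤ T} {S : Finset (Fin N) // S.card ≤ T} ℝ → Prop :=
    fun A => ∃ (m : ℕ) (q : Fin m → MvPolynomial (Fin N) ℝ), (∀ j, (q j).totalDegree ≤ T) ∧
      ∀ x : Fin N → Bool, ∑ a, ∑ b, A a b * (walsh a.1 x * walsh b.1 x) = ∑ j, evalBool (q j) x ^ 2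
  -- zero
  have h0 : P 0 := ⟨0, Fin.elim0, fun j => j.elim0, fun x => by simp⟩
  -- additivity
  have hadd : ∀ A B, P A → P B → P (A + B) := by
    rintro A B ⟨m₁, q₁, hd₁, hv₁⟩ ⟨m₂, q₂, hd₂, hv₂⟩
    refine ⟨m₁ + m₂, Fin.addCases q₁ q₂, fun j => ?_, fun x => ?_⟩
    · refine Fin.addCases (fun i => ?_) (fun i => ?_) j
      · simpa using hd₁ i
      · simpa using hd₂ i
    · rw [Fin.sum_univ_add]
      simp only [Fin.addCases_left, Fin.addCases_right, Matrix.add_apply]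
      rw [← hv₁ x, ← hv₂ x, ← Finset.sum_add_distrib]
      refine Finset.sum_congr rfl fun a _ => ?_
      rw [← Finset.sum_add_distrib]
      exact Finset.sum_congr rfl fun b _ => by ring
  -- generators star s * s
  have hgen : ∀ s : Matrix {S : Finset (Fin N) // S.card ≤ T} {S : Finset (Fin N) // S.card ≤ T} ℝ,
      P (star s * s) := by
    intro s
    let e := Fintype.equivFin {S : Finset (Fin N) // S.card ≤ T}
    let qf : {S : Finset (Fin N) // S.card ≤ T} → MvPolynomial (Fin N) ℝ :=
      fun j => ∑ a, C (s j a) * ∏ i ∈ a.1, (1 - 2 * X i : MvPolynomial (Fin N) ℝ)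
    have hqdeg : ∀ j, (qf j).totalDegree ≤ T := by
      intro j
      refine (totalDegree_finsetSum _ _).trans (Finset.sup_le fun a _ => ?_)
      refine (totalDegree_mul _ _).trans ?_
      rw [totalDegree_C, zero_add]
      exact (totalDegree_walshProd_le a.1).trans a.2
    have hqev : ∀ j x, evalBool (qf j) x = ∑ a, s j a * walsh a.1 x := by
      intro j x
      simp only [qf]
      unfold evalBool
      rw [map_sum]
      refine Finset.sum_congr rfl fun a _ => ?_
      rw [map_mul, eval_C]
      congr 1
      exact evalBool_walshProd a.1 x
    refine ⟨Fintype.card {S : Finset (Fin N) // S.card ≤ T}, fun k => qf (e.symm k), fun k => hqdeg _,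
      fun x => ?_⟩
    rw [Equiv.sum_comp e.symm (fun j => evalBool (qf j) x ^ 2)]
    simp_rw [hqev]
    have hmul : ∀ a b : {S : Finset (Fin N) // S.card ≤ T}, (star s * s) a b = ∑ j, s j a * s j b := by
      intro a b
      rw [Matrix.star_eq_conjTranspose, Matrix.mul_apply]
      refine Finset.sum_congr rfl fun j _ => ?_
      rw [conjTranspose_apply, star_trivial]
    simp_rw [hmul]
    -- Σ_a Σ_b (Σ_j s_ja s_jb) χ_a χ_b = Σ_j (Σ_a s_ja χ_a)²
    have e2 : ∀ j, (∑ a, s j a * walsh a.1 x) ^ 2 =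
        ∑ a, ∑ b, s j a * s j b * (walsh a.1 x * walsh b.1 x) := by
      intro j; rw [sq, Finset.sum_mul_sum]
      refine Finset.sum_congr rfl fun a _ => Finset.sum_congr rfl fun b _ => ?_; ring
    simp_rw [e2]
    symm
    rw [Finset.sum_comm]
    refine Finset.sum_congr rfl fun a _ => ?_
    rw [Finset.sum_comm]
    refine Finset.sum_congr rfl fun b _ => ?_
    rw [Finset.sum_mul]
  -- closure induction from `0 ≤ Q`
  have hQ' : (0 : Matrix _ _ ℝ) ≤ Q := Matrix.nonneg_iff_posSemidef.mpr hQ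
  rw [StarOrderedRing.nonneg_iff] at hQ'
  refine AddSubmonoid.closure_induction (motive := fun A _ => P A) ?_ h0 (fun A B _ _ hA hB => hadd A B hA hB) hQ'
  rintro A ⟨s, rfl⟩
  exact hgen s

/-- **The SOS cone in the Walsh basis**: `f` is a sum of squares of polynomials of total degree `≤ T` on the cube
iff `f = Σ_{a,b} Q_{ab} χ_a χ_b` for some positive semidefinite `Q` over the sets of size `≤ T`. [folklore] -/
theorem sos_iff_exists_psd (T : ℕ) (f : (Fin N → Bool) → ℝ) :
    (∃ (m : ℕ) (q : Fin m → MvPolynomial (Fin N) ℝ), (∀ j, (q j).totalDegree ≤ T) ∧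
        ∀ x, f x = ∑ j, evalBool (q j) x ^ 2) ↔
      ∃ Q : Matrix {S : Finset (Fin N) // S.card ≤ T} {S : Finset (Fin N) // S.card ≤ T} ℝ,
        Q.PosSemidef ∧ ∀ x, f x = ∑ a, ∑ b, Q a b * (walsh a.1 x * walsh b.1 x) := by
  constructor
  · rintro ⟨m, q, hdeg, hf⟩
    obtain ⟨Q, hQ, hrep⟩ := exists_psd_of_sos q hdeg
    exact ⟨Q, hQ, fun x => (hf x).trans (hrep x)⟩
  · rintro ⟨Q, hQ, hf⟩
    obtain ⟨m, q, hdeg, hrep⟩ := sos_of_psd Q hQ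
    exact ⟨m, q, hdeg, fun x => (hf x).trans (hrep x)⟩


/-! ### Closedness of the SOS cone -/

/-- Trace identity: `Σ_x Σ_{a,b} Q_{ab} χ_a(x)χ_b(x) = 2^N · tr Q` (orthogonality of characters). [cite: ODonnell2014, §1.4] -/
theorem sum_gram_eq_trace {T : ℕ}
    (Q : Matrix {S : Finset (Fin N) // S.card ≤ T} {S : Finset (Fin N) // S.card ≤ T} ℝ) :
    ∑ x : Fin N → Bool, ∑ a, ∑ b, Q a b * (walsh a.1 x * walsh b.1 x) = 2 ^ N * ∑ a, Q a a := by
  classical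
  rw [Finset.sum_comm]
  have e1 : ∀ a : {S : Finset (Fin N) // S.card ≤ T},
      ∑ x : Fin N → Bool, ∑ b, Q a b * (walsh a.1 x * walsh b.1 x) = 2 ^ N * Q a a := by
    intro a
    rw [Finset.sum_comm]
    have e2 : ∀ b : {S : Finset (Fin N) // S.card ≤ T},
        ∑ x : Fin N → Bool, Q a b * (walsh a.1 x * walsh b.1 x) = Q a b * (if a = b then (2 : ℝ) ^ N else 0) := by
      intro b
      rw [← Finset.mul_sum, sum_walsh_mul_walsh_index]
      congr 1
      by_cases h : a = b
      · subst h; simp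
      · have h' : a.1 ≠ b.1 := fun e => h (Subtype.ext e)
        rw [if_neg h', if_neg h]
    simp_rw [e2]
    simp [Finset.sum_ite_eq]
    ring
  simp_rw [e1]
  rw [Finset.mul_sum]

/-- Entries of a real positive semidefinite matrix are bounded by its trace. [folklore] -/
theorem abs_entry_le_trace {ι : Type*} [Fintype ι] [DecidableEq ι] {Q : Matrix ι ι ℝ}
    (hQ : Q.PosSemidef) (a b : ι) : |Q a b| ≤ ∑ c, Q c c := by
  have hdiag : ∀ c, 0 ≤ Q c c := fun c => hQ.diag_nonneg
  have hsym : Q b a = Q a b := by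
    have h := hQ.1.apply b a
    simpa using h.symm
  have hdet := (hQ.submatrix ![a, b]).det_nonneg
  rw [Matrix.det_fin_two] at hdet
  simp only [Matrix.submatrix_apply, Matrix.cons_val_zero, Matrix.cons_val_one] at hdet
  rw [hsym] at hdet
  -- Q a b ^ 2 ≤ Q a a * Q b b ≤ ((Q a a + Q b b)/2)^2
  have hab : |Q a b| ≤ (Q a a + Q b b) / 2 := by
    rw [abs_le]
    constructor <;> nlinarith [hdiag a, hdiag b, sq_nonneg (Q a a - Q b b), sq_nonneg (Q a b)]
  have ha : Q a a ≤ ∑ c, Q c c := Finset.single_le_sum (fun c _ => hdiag c) (Finset.mem_univ a)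
  have hb : Q b b ≤ ∑ c, Q c c := Finset.single_le_sum (fun c _ => hdiag c) (Finset.mem_univ b)
  linarith

/-- The set of (entry functions of) real positive semidefinite matrices is closed. [folklore] -/
theorem isClosed_setOf_posSemidef {ι : Type*} [Fintype ι] [DecidableEq ι] :
    IsClosed {F : ι → ι → ℝ | (Matrix.of F).PosSemidef} := by
  have hrw : {F : ι → ι → ℝ | (Matrix.of F).PosSemidef} =
      {F : ι → ι → ℝ | ∀ i j, F j i = F i j} ∩ {F | ∀ v : ι → ℝ, 0 ≤ v ⬝ᵥ ((Matrix.of F) *ᵥ v)} := by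
    ext F
    simp only [Set.mem_setOf_eq, Set.mem_inter_iff, Matrix.posSemidef_iff_dotProduct_mulVec, star_trivial]
    constructor
    · rintro ⟨h1, h2⟩
      exact ⟨fun i j => by simpa using h1.apply i j, h2⟩
    · rintro ⟨h1, h2⟩
      refine ⟨?_, h2⟩
      ext i j
      simpa using h1 i j
  rw [hrw]
  refine IsClosed.inter ?_ ?_
  · simp only [Set.setOf_forall]
    refine isClosed_iInter fun i => isClosed_iInter fun j => isClosed_eq ?_ ?_
    · exact continuous_apply_apply j i
    · exact continuous_apply_apply i j
  · simp only [Set.setOf_forall]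
    refine isClosed_iInter fun v => isClosed_le continuous_const ?_
    unfold dotProduct Matrix.mulVec
    refine continuous_finsetSum _ fun i _ => continuous_const.mul ?_
    unfold dotProduct
    refine continuous_finsetSum _ fun j _ => ?_
    simp only [Matrix.of_apply]
    exact (continuous_apply_apply i j).mul continuous_const

/-- **The SOS cone of order `T` is closed** (Gram representation; `|Q_{ab}| ≤ tr Q = E_x f(x)`; compactness). [folklore] -/
theorem isClosed_sos (T : ℕ) :
    IsClosed {f : (Fin N → Bool) → ℝ | ∃ (m : ℕ) (q : Fin m → MvPolynomial (Fin N) ℝ),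
      (∀ j, (q j).totalDegree ≤ T) ∧ ∀ x, f x = ∑ j, evalBool (q j) x ^ 2} := by
  classical
  let Φ : ({S : Finset (Fin N) // S.card ≤ T} → {S : Finset (Fin N) // S.card ≤ T} → ℝ) →
      ((Fin N → Bool) → ℝ) := fun F x => ∑ a, ∑ b, F a b * (walsh a.1 x * walsh b.1 x)
  have hΦ : Continuous Φ := by
    refine continuous_pi fun x => ?_
    refine continuous_finsetSum _ fun a _ => continuous_finsetSum _ fun b _ => ?_
    exact (continuous_apply_apply a b).mul continuous_const
  have hset : {f : (Fin N → Bool) → ℝ | ∃ (m : ℕ) (q : Fin m → MvPolynomial (Fin N) ℝ),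
      (∀ j, (q j).totalDegree ≤ T) ∧ ∀ x, f x = ∑ j, evalBool (q j) x ^ 2} =
      Φ '' {F | (Matrix.of F).PosSemidef} := by
    ext f
    rw [Set.mem_setOf_eq, sos_iff_exists_psd, Set.mem_image]
    constructor
    · rintro ⟨Q, hQ, hf⟩
      exact ⟨fun a b => Q a b, hQ, (funext hf).symm⟩
    · rintro ⟨F, hF, hf⟩
      exact ⟨Matrix.of F, hF, fun x => by rw [← hf]; simp [Φ, Matrix.of_apply]⟩
  rw [hset]
  refine isClosed_of_closure_subset fun f hf => ?_
  obtain ⟨u, hu, hlim⟩ := mem_closure_iff_seq_limit.mp hf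
  choose F hFpsd hFu using hu
  -- the Gram data are bounded by the sup norm of the functions
  obtain ⟨R, hR⟩ : ∃ R, ∀ n, ‖u n‖ ≤ R := by
    obtain ⟨R, hR⟩ := (Metric.isBounded_range_of_tendsto u hlim).exists_norm_le
    exact ⟨R, fun n => hR _ (Set.mem_range_self n)⟩
  have hR0 : 0 ≤ R := (norm_nonneg _).trans (hR 0)
  have hFbd : ∀ n, ‖F n‖ ≤ R := by
    intro n
    refine (pi_norm_le_iff_of_nonneg hR0).mpr fun a => (pi_norm_le_iff_of_nonneg hR0).mpr fun b => ?_
    rw [Real.norm_eq_abs]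
    have hab : |F n a b| ≤ ∑ c, F n c c := by
      simpa [Matrix.of_apply] using abs_entry_le_trace (hFpsd n) a b
    refine hab.trans ?_
    have htr : (2 : ℝ) ^ N * ∑ c, F n c c = ∑ x : Fin N → Bool, u n x := by
      rw [← hFu n]
      exact (sum_gram_eq_trace (Matrix.of (F n))).symm
    have hsum : ∑ x : Fin N → Bool, u n x ≤ ∑ _x : Fin N → Bool, R :=
      Finset.sum_le_sum fun x _ =>
        (le_abs_self _).trans ((Real.norm_eq_abs _ ▸ norm_le_pi_norm (u n) x).trans (hR n))
    rw [Finset.sum_const, Finset.card_univ, nsmul_eq_mul] at hsum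
    have hcard : (Fintype.card (Fin N → Bool) : ℝ) = 2 ^ N := by simp
    rw [hcard] at hsum
    have h2 : (0 : ℝ) < 2 ^ N := by positivity
    nlinarith
  have hmem : ∀ n, F n ∈ Metric.closedBall
      (0 : {S : Finset (Fin N) // S.card ≤ T} → {S : Finset (Fin N) // S.card ≤ T} → ℝ) R := fun n => by
    rw [Metric.mem_closedBall, dist_zero_right]; exact hFbd n
  obtain ⟨Flim, -, φ, hφ, hφlim⟩ := (isCompact_closedBall _ R).tendsto_subseq hmem
  have hFlim : (Matrix.of Flim).PosSemidef :=
    isClosed_setOf_posSemidef.mem_of_tendsto hφlim (Filter.Eventually.of_forall fun n => hFpsd (φ n))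
  have hflim : f = Φ Flim := by
    have h1 : Filter.Tendsto (u ∘ φ) Filter.atTop (nhds f) := hlim.comp hφ.tendsto_atTop
    have h2 : Filter.Tendsto (u ∘ φ) Filter.atTop (nhds (Φ Flim)) := by
      have : u ∘ φ = Φ ∘ (F ∘ φ) := by funext n; simp [hFu]
      rw [this]
      exact (hΦ.tendsto Flim).comp hφlim
    exact tendsto_nhds_unique h1 h2
  exact ⟨Flim, hFlim, hflim.symm⟩

end Summit.QuantumAdvantage.QuantumAdvantage.Theorems.SosSandwich
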